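import Literature.MathematicalPhysics.QuantumFieldTheory.CubicalCochains
import HarnessLib

/-!
# Cubical cochains on `ℤ^d`: the Poincaré lemma in degree one on a box

Companion of `CubicalCochains.lean` (same namespace `…QuantumFieldTheory.LatticeForm`). For a
box `[a, b] ⊆ ℤ^d` (product of integer intervals, Mathlib `Set.Icc a b` for the product order on
`Site d = Fin d → ℤ`) and a `1`-cochain `V` with values in an abelian group which is **flat on the
box** — `d₁ V (x; i, j) = 0` for every plaquette with corners `x` and `x + eᵢ + eⱼ` in the box — we
construct a `0`-cochain `g` with `d₀ g = V` on every edge of the box (`x` and `x + eᵢ` in the box):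
`LatticeForm.exists_d₀_eq_of_flat_on_box`. The primitive is the lattice line integral of `V` from
the corner `a` along the coordinate axes taken in increasing order (`boxPrim`), and the proof is
the usual induction on the number of axes, path independence being supplied by flatness
(telescoping along the last axis). In gauge-theory language: an abelian lattice gauge field
whose plaquette variables are trivial on a box is a pure gauge on that box; consequently a
gauge-invariant observable supported in a box is a function of the plaquette variables in the box
(used for the observables of the `ℤ_n` contour expansion). Everything here is proved.

## References

* M. P. Forsström, J. Lenells, F. Viklund, *Wilson loops in finite Abelian lattice gauge
  theories*, Ann. Inst. H. Poincaré Probab. Stat. 58 (2022), §2 (Lemma 2.2: the Poincaré lemma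
  on boxes; §2.3 gauge-invariant functions as functions of `dσ`). [ForsstromLenellsViklund2022]
-/

open Finset Function

namespace Literature.MathematicalPhysics.QuantumFieldTheory

namespace LatticeForm

open Literature.Probability.LatticeModels (Site)

variable {d : ℕ} {A : Type*} [AddCommGroup A]

/-- Telescoping along an axis above the starting height, for an arbitrary summand:
`axisPrim F (x + eℓ) - axisPrim F x = F x` when `a ≤ x_ℓ`. [folklore] -/
theorem axisPrim_add_single_sub_of_le (F : Site d → A) (ℓ : Fin d) (a : ℤ) {x : Site d}
    (hx : a ≤ x ℓ) : axisPrim F ℓ a (x + e ℓ) - axisPrim F ℓ a x = F x := by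
  unfold axisPrim
  rw [axisSum_add_single_self, add_single_apply_self]
  have h1 : (x ℓ + 1 - a).toNat = (x ℓ - a).toNat + 1 := by omega
  rw [h1, axisSum_succ, add_sub_cancel_left]
  congr 1
  have : a + ((x ℓ - a).toNat : ℤ) = x ℓ := by omega
  rw [this, update_eq_self]

/-- The lattice line integral of the `1`-cochain `V` from the corner `a` to `x` along the axes
`0, 1, …, k-1` in this order (the remaining coordinates of the path being frozen):
`boxPrim V a (k+1) x = boxPrim V a k (x with x_k := a_k) + ∑_{a_k ≤ t < x_k} V((x, x_k := t); k)`.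
[folklore] -/
def boxPrim (V : Site d → Fin d → A) (a : Site d) : ℕ → Site d → A
  | 0 => fun _ => 0
  | k + 1 => fun x =>
    if h : k < d then
      boxPrim V a k (update x ⟨k, h⟩ (a ⟨k, h⟩)) + axisPrim (fun y => V y ⟨k, h⟩) ⟨k, h⟩ (a ⟨k, h⟩) x
    else boxPrim V a k x

/-- Edges of a box have both endpoints in it, so in particular `a ≤ b` coordinatewise there;
a point of the box between `a` and another point of the box is in the box. [folklore] -/
theorem update_mem_Icc_of_mem {a b x : Site d} (hx : x ∈ Set.Icc a b) (ℓ : Fin d) {t : ℤ}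
    (ht : a ℓ ≤ t ∧ t ≤ b ℓ) : update x ℓ t ∈ Set.Icc a b :=
  update_mem_Icc_iff.2 ⟨ht, ((mem_Icc_iff_inBoxAway ℓ).1 hx).2⟩

/-- **Poincaré lemma in degree one on a box** (flat ⇒ pure gauge). If the `1`-cochain `V` is flat
on the box `[a, b]`, i.e. `d₁ V (x; i, j) = 0` whenever `x` and `x + eᵢ + eⱼ` lie in the box, then
there is a `0`-cochain `g` with `g (x + eᵢ) - g x = V (x, i)` for every edge of the box (`x` and
`x + eᵢ` in `[a, b]`). [cite: ForsstromLenellsViklund2022, §2 (Lemma 2.2, the Poincaré lemma)] -/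
theorem exists_d₀_eq_of_flat_on_box (V : Site d → Fin d → A) (a b : Site d)
    (hflat : ∀ (x : Site d) (i j : Fin d), x ∈ Set.Icc a b → x + e i + e j ∈ Set.Icc a b →
      d₁ V x i j = 0) :
    ∃ g : Site d → A, ∀ (x : Site d) (i : Fin d), x ∈ Set.Icc a b → x + e i ∈ Set.Icc a b →
      d₀ g x i = V x i := by
  classical
  -- the invariant of the induction on the number `k` of integrated axes
  have key : ∀ k : ℕ, k ≤ d → ∀ (x : Site d), x ∈ Set.Icc a b →
      (∀ m : Fin d, k ≤ m.val → x m = a m) →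
      ∀ i : Fin d, i.val < k → x + e i ∈ Set.Icc a b →
        boxPrim V a k (x + e i) - boxPrim V a k x = V x i := by
    intro k
    induction k with
    | zero => intro _ x _ _ i hi; exact absurd hi (Nat.not_lt_zero _)
    | succ k ih =>
      intro hk x hx hreset i hi hxi
      have hkd : k < d := by omega
      set κ : Fin d := ⟨k, hkd⟩ with hκ
      have hres' : ∀ m : Fin d, k ≤ m.val → m ≠ κ → x m = a m := fun m hm hne =>
        hreset m (by
          have : m.val ≠ k := fun h => hne (Fin.ext h)
          omega)
      -- the point `π x = (x with x_k := a_k)` satisfies the invariant at stage `k`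
      have hπmem : update x κ (a κ) ∈ Set.Icc a b :=
        update_mem_Icc_of_mem hx κ ⟨le_rfl, ((mem_Icc_iff_inBoxAway κ).1 hx).1.1.trans
          ((mem_Icc_iff_inBoxAway κ).1 hx).1.2⟩
      have hπreset : ∀ m : Fin d, k ≤ m.val → update x κ (a κ) m = a m := by
        intro m hm
        by_cases hmκ : m = κ
        · subst hmκ; exact update_self ..
        · rw [update_of_ne hmκ]; exact hres' m hm hmκ
      simp only [boxPrim, dif_pos hkd]
      rcases Nat.lt_or_ge i.val k with hik | hik
      · -- an axis already integrated: `i < k`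
        have hiκ : i ≠ κ := fun h => by rw [h] at hik; exact lt_irrefl _ hik
        rw [update_add_single_of_ne x hiκ]
        have h1 := ih hkd.le (update x κ (a κ)) hπmem hπreset i hik (by
          rw [← update_add_single_of_ne x hiκ]
          exact update_mem_Icc_of_mem hxi κ ⟨le_rfl, ((mem_Icc_iff_inBoxAway κ).1 hx).1.1.trans
            ((mem_Icc_iff_inBoxAway κ).1 hx).1.2⟩)
        -- the primitive along `κ` changes by a telescoping sum of `V(·; i)` (flatness)
        have h2 : axisPrim (fun y => V y κ) κ (a κ) (x + e i) - axisPrim (fun y => V y κ) κ (a κ) x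
            = V x i - V (update x κ (a κ)) i := by
          simp only [axisPrim, add_single_apply_of_ne x (Ne.symm hiκ), axisSum_add_single_of_ne _ hiκ]
          simp only [axisSum, ← Finset.sum_sub_distrib]
          -- flatness on the plaquettes `(z_n; i, κ)`, `z_n = (x, x_κ := a_κ + n)`
          have hstep : ∀ n ∈ Finset.range (x κ - a κ).toNat,
              V (update x κ (a κ + n) + e i) κ - V (update x κ (a κ + n)) κ =
                V (update x κ (a κ + (n + 1 : ℕ))) i - V (update x κ (a κ + n)) i := by
            intro n hn
            have hn' : (n : ℤ) < (x κ - a κ).toNat := by exact_mod_cast Finset.mem_range.1 hn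
            have hxκ := ((mem_Icc_iff_inBoxAway κ).1 hx).1
            have hzmem : update x κ (a κ + n) ∈ Set.Icc a b :=
              update_mem_Icc_of_mem hx κ ⟨by omega, by omega⟩
            have hzmem' : update x κ (a κ + n) + e i + e κ ∈ Set.Icc a b := by
              rw [add_right_comm, update_add_single_eq, ← update_add_single_of_ne x hiκ]
              refine update_mem_Icc_of_mem hxi κ ⟨by omega, ?_⟩
              have := ((mem_Icc_iff_inBoxAway κ).1 hxi).1.2
              rw [add_single_apply_of_ne x (Ne.symm hiκ)] at this  -- `(x + e i) κ = x κ`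
              omega
            have hf := hflat _ i κ hzmem hzmem'
            simp only [d₁] at hf
            rw [update_add_single_eq] at hf
            push_cast
            rw [← add_assoc]
            -- `hf : V z i + V (z + e i) κ - V z' i - V z κ = 0` with `z' = z + e κ`
            have : V (update x κ (a κ + n) + e i) κ - V (update x κ (a κ + n)) κ -
                (V (update x κ (a κ + n + 1)) i - V (update x κ (a κ + n)) i) =
                V (update x κ (a κ + ↑n)) i + V (update x κ (a κ + ↑n) + e i) κ -
                  V (update x κ (a κ + ↑n + 1)) i - V (update x κ (a κ + ↑n)) κ := by abel
            exact sub_eq_zero.1 (this.trans hf)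
          rw [Finset.sum_congr rfl hstep, Finset.sum_range_sub (f := fun n : ℕ => V (update x κ (a κ + n)) i)]
          have hxκ := ((mem_Icc_iff_inBoxAway κ).1 hx).1
          have : a κ + (((x κ - a κ).toNat : ℕ) : ℤ) = x κ := by omega
          simp only [this, update_eq_self, Nat.cast_zero, add_zero]
        -- assemble
        have : boxPrim V a k (update x κ (a κ) + e i) + axisPrim (fun y => V y κ) κ (a κ) (x + e i) -
            (boxPrim V a k (update x κ (a κ)) + axisPrim (fun y => V y κ) κ (a κ) x) =
            (boxPrim V a k (update x κ (a κ) + e i) - boxPrim V a k (update x κ (a κ))) +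
            (axisPrim (fun y => V y κ) κ (a κ) (x + e i) - axisPrim (fun y => V y κ) κ (a κ) x) := by
          abel
        rw [this, h1, h2]
        abel
      · -- the new axis: `i = κ`
        have hiκ : i = κ := Fin.ext (by simp [hκ]; omega)
        subst hiκ
        rw [update_add_single_self]
        have h2 := axisPrim_add_single_sub_of_le (fun y => V y κ) κ (a κ)
          ((mem_Icc_iff_inBoxAway κ).1 hx).1.1
        rw [← h2]; abel
  exact ⟨boxPrim V a d, fun x i hx hxi => key d le_rfl x hx (fun m hm => absurd m.2 (by omega)) i i.2 hxi⟩

end LatticeForm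

end Literature.MathematicalPhysics.QuantumFieldTheory
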